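import Mathlib
import Summits.ResolutionOfSingularities.ResolutionOfSingularities.Theorems.HomologicalConductorNoZenoSplitModelLocalPrime
import HarnessLib

/-!
# D2′ PART 3a: the upstairs model, prime and germ of the splitting base change (`splitModel`)

W4.4 (crux `NoZenoR`, stmt-ResolutionOfSingularities-19943), `stub_L1wCore` route (F1), descent
step (B2) of `L1W-PREP-v2.md` §2.1 (res-L0-w44-stub-2).  The thread-free core `Sig.L1Core`
(res-L0-w44-lead-1) quantifies over a model `T : Subalgebra k K`, a prime `P`, the germ
`D := locPrime T P` and ring-level side conditions.  The (F1) route base-changes `D` along the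
local-étale `D → D[X]/(f)` for a monic `f ∈ D[X]` with irreducible separable reduction modulo
`𝔪_D` (BC-0, `…NoZenoSplittingBase`).  For ANY local `k`-subalgebra `D ⊆ K` (the germ
`locPrimeSubalgebra T P` is one — the model is RE-BASED AT THE GERM, which `Sig.L1Core` allows since
it only asks the model to be essentially of finite type) this file constructs, concretely:

* the upstairs MODEL `splitModel D f = D[β] ⊆ K_f := K[X]/(f_K)` (`f_K` irreducible by Gauss,
  `irreducible_map_germ`), `splitEquiv : D[X]/(f) ≃ₐ[k] D[β]`, with `Frac D[β] = K_f`
  (`isFractionRing_splitModel`), essentially of finite type (`essFiniteType_splitModel`), normal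
  (`isIntegrallyClosed_splitModel`, BC-N♯) and LOCAL (`isLocalRing_splitModel`);
* the upstairs PRIME `splitPrime D f = 𝔪_D·D[β]`, the maximal ideal (`splitPrime_eq_maximalIdeal`),
  lying over `𝔪_D` (`toSplitModel_mem_splitPrime_iff`);
* the upstairs GERM `locPrime (D[β]) (𝔪_D·D[β]) = D[β]` (`locPrime_splitPrime_eq`), isomorphic to
  `D[X]/(f)` over `D` (`splitGermAlgEquiv`), the base change `D → D_f` being a registered `Algebra`
  instance (`germAlgebra`, the inclusion along `K → K_f`: `coe_algebraMap_germ`), and its LOCAL-ÉTALE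
  BUNDLE in the vocabulary of the named facts `Lipman1969_16_1_ii` / `Lipman1969_16_5`:
  `isLocalHom_germ`, `map_maximalIdeal_germ` (`𝔪_D·D_f = 𝔪_(D_f)`), `flat_germ`, `finite_germ`,
  `etale_germ`, `isNoetherianRing_germ`, THE SPLITTING `nonempty_residueField_algEquiv`
  (`κ(D_f) ≃ₐ[κ(D)] κ(D)[X]/(f̄)`), `isSeparable_residueField_germ`, `ringKrullDim_germ`
  (`dim D_f = dim D`), `isRegularLocalRing_germ_iff`, `isIntegrallyClosed_germ`.

The specialisation to `D = locPrimeSubalgebra T P` (prime over `P`, the `𝔪`-primary binder, the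
packaging `exists_splitData`) is `…NoZenoSplitDataThread`; the chart side (`B`, `nrm B`, `𝔮`, `D'`) is
D2′ part 4.  OURS (cell res-hironaka, chain W4.4); AI-written, weaker than expert review; nothing
here is a statement of the manuscript under review (Hironaka 2017); no Theses file is imported.
-/
noncomputable section

set_option linter.dupNamespace false

open IsLocalRing Polynomial
open Summit.ResolutionOfSingularities.ResolutionOfSingularities.Theorems.NoZeno.SandwichCluster
open Parasite (locPrime isLocalRing_locPrime)
open Thread (toSubring_le_locPrime)

namespace Summit.ResolutionOfSingularities.ResolutionOfSingularities.Theorems.NoZeno.SplittingBase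

variable {k K : Type} [Field k] [Field K] [Algebra k K]

/-- Any explicit prime localisation `locPrime T P` is a local ring — instance form of
`Parasite.isLocalRing_locPrime` (keyed on an instance `[P.IsPrime]`; any two proofs of primality
give the same subring). [this work] -/
instance instIsLocalRingLocPrime {L : Type} [Field L] [Algebra k L] (S : Subalgebra k L)
    (Q : Ideal ↥S) [hQ : Q.IsPrime] : IsLocalRing ↥(locPrime S Q hQ) :=
  isLocalRing_locPrime S Q hQ

/-! ## The upstairs model `D[β] ⊆ K_f` of a local `k`-subalgebra `D ⊆ K` -/

section Model

variable (D : Subalgebra k K) (f : (↥D)[X])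

/-- `Φ : D[X]/(f) →ₐ[k] K_f := K[X]/(f_K)` (`root ↦ root`, `D ⊆ K ⊆ K_f`). [this work] -/
def modelHom : AdjoinRoot f →ₐ[k] AdjoinRoot (f.map (algebraMap ↥D K)) :=
  (AdjoinRoot.liftAlgHom f (Algebra.ofId ↥D (AdjoinRoot (f.map (algebraMap ↥D K))))
    (AdjoinRoot.root (f.map (algebraMap ↥D K))) (eval₂_root_map_eq_zero D f)).restrictScalars k

/-- `Φ` on constants. [this work] -/
theorem modelHom_of (d : ↥D) :
    modelHom D f (AdjoinRoot.of f d) = algebraMap K (AdjoinRoot (f.map (algebraMap ↥D K))) (d : K) := by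
  rw [modelHom, AlgHom.restrictScalars_apply, AdjoinRoot.liftAlgHom_of]
  exact IsScalarTower.algebraMap_apply ↥D K _ d

/-- `Φ` on the root. [this work] -/
theorem modelHom_root :
    modelHom D f (AdjoinRoot.root f) = AdjoinRoot.root (f.map (algebraMap ↥D K)) := by
  rw [modelHom, AlgHom.restrictScalars_apply, AdjoinRoot.liftAlgHom_root]

/-- `Φ` on classes of polynomials. [this work] -/
theorem modelHom_mk (g : (↥D)[X]) :
    modelHom D f (AdjoinRoot.mk f g) = AdjoinRoot.mk (f.map (algebraMap ↥D K)) (g.map (algebraMap ↥D K)) := by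
  rw [modelHom, AlgHom.restrictScalars_apply, AdjoinRoot.liftAlgHom_mk, ← AdjoinRoot.aeval_eq,
    aeval_map_algebraMap, aeval_def]
  rfl

/-- `Φ` is injective for `f` monic. [this work] -/
theorem modelHom_injective (hf : f.Monic) : Function.Injective (modelHom D f) :=
  fun _ _ h => injective_liftAlgHom_root D f hf h

/-- **The upstairs model** `T_f := D[β] ⊆ K_f`, the image of `Φ`. [this work] -/
def splitModel : Subalgebra k (AdjoinRoot (f.map (algebraMap ↥D K))) := (modelHom D f).range

/-- `D[X]/(f) ≃ₐ[k] D[β]` (`f` monic). [this work] -/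
def splitEquiv (hf : f.Monic) : AdjoinRoot f ≃ₐ[k] ↥(splitModel D f) :=
  AlgEquiv.ofInjective (modelHom D f) (modelHom_injective D f hf)

/-- Underlying element of `splitEquiv`. [this work] -/
theorem coe_splitEquiv (hf : f.Monic) (x : AdjoinRoot f) :
    ((splitEquiv D f hf x : ↥(splitModel D f)) : AdjoinRoot (f.map (algebraMap ↥D K))) = modelHom D f x :=
  rfl

/-- **The germ-to-model map `D → D[β]`** (on elements: the inclusion along `K → K_f`). [this work] -/
def toSplitModel : ↥D →+* ↥(splitModel D f) :=
  ((modelHom D f).rangeRestrict.toRingHom).comp (algebraMap ↥D (AdjoinRoot f))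

/-- `toSplitModel` on elements. [this work] -/
theorem coe_toSplitModel (d : ↥D) :
    ((toSplitModel D f d : ↥(splitModel D f)) : AdjoinRoot (f.map (algebraMap ↥D K))) =
      algebraMap K (AdjoinRoot (f.map (algebraMap ↥D K))) (d : K) := by
  rw [← modelHom_of, ← AdjoinRoot.algebraMap_eq]
  rfl

/-- `toSplitModel = splitEquiv ∘ (D → D[X]/(f))`. [this work] -/
theorem toSplitModel_eq (hf : f.Monic) (d : ↥D) :
    toSplitModel D f d = splitEquiv D f hf (algebraMap ↥D (AdjoinRoot f) d) :=
  Subtype.ext rfl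

/-- Elements of `D` (read in `K_f`) lie in the model. [this work] -/
theorem algebraMap_mem_splitModel {x : K} (hx : x ∈ D) :
    algebraMap K (AdjoinRoot (f.map (algebraMap ↥D K))) x ∈ splitModel D f := by
  have h := (toSplitModel D f ⟨x, hx⟩).2
  rwa [coe_toSplitModel] at h

/-- The root `β` lies in the model. [this work] -/
theorem root_mem_splitModel : AdjoinRoot.root (f.map (algebraMap ↥D K)) ∈ splitModel D f :=
  ⟨AdjoinRoot.root f, modelHom_root D f⟩

/-- **Gauss.** For a normal `D` with `Frac D = K` local, `f` monic with irreducible reduction modulo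
`𝔪_D` is irreducible over `K`, so that `K_f` is a field. [folklore] -/
theorem irreducible_map_germ [IsFractionRing ↥D K] [IsIntegrallyClosed ↥D] [IsLocalRing ↥D]
    (hf : f.Monic) (hirr : Irreducible (f.map (residue ↥D))) :
    Irreducible (f.map (algebraMap ↥D K)) :=
  irreducible_map_of_irreducible_map_residue D f hf (maximalIdeal ↥D) hirr

/-- **`Frac (D[β]) = K_f`** when `Frac D = K` (every class is `g(β)/b` with `g ∈ D[X]`, `b ∈ D`;
pattern of res-L0-w44-stub-2's `exists_splitModel`). [this work] -/
theorem isFractionRing_splitModel [IsFractionRing ↥D K] (hf : f.Monic)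
    [Fact (Irreducible (f.map (algebraMap ↥D K)))] :
    IsFractionRing ↥(splitModel D f) (AdjoinRoot (f.map (algebraMap ↥D K))) := by
  refine IsFractionRing.of_field _ _ fun z => ?_
  obtain ⟨g, rfl⟩ := AdjoinRoot.mk_surjective z
  obtain ⟨b, hbM, hb⟩ := IsLocalization.integerNormalization_spec (nonZeroDivisors ↥D) g
  have hb0 : ((b : ↥D) : K) ≠ 0 := fun h => nonZeroDivisors.ne_zero hbM (Subtype.ext h)
  refine ⟨splitEquiv D f hf (AdjoinRoot.mk f (IsLocalization.integerNormalization (nonZeroDivisors ↥D) g)),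
    toSplitModel D f b, ?_⟩
  simp only [Subalgebra.algebraMap_apply]
  rw [coe_splitEquiv, modelHom_mk, coe_toSplitModel]
  have hb' : (IsLocalization.integerNormalization (nonZeroDivisors ↥D) g).map (algebraMap ↥D K) =
      C ((b : ↥D) : K) * g := by
    rw [hb, Algebra.smul_def, Polynomial.algebraMap_apply]
    rfl
  rw [hb', map_mul, AdjoinRoot.mk_C, mul_comm, ← AdjoinRoot.algebraMap_eq,
    mul_div_cancel_right₀ _ ((map_ne_zero_iff _ (algebraMap K _).injective).mpr hb0)]

/-- **`D[β]` is essentially of finite type over `k`** when `D` is. [this work] -/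
theorem essFiniteType_splitModel [Algebra.EssFiniteType k ↥D] (hf : f.Monic) :
    Algebra.EssFiniteType k ↥(splitModel D f) := by
  haveI : Algebra.EssFiniteType ↥D (AdjoinRoot f) := inferInstance
  haveI : Algebra.EssFiniteType k (AdjoinRoot f) := Algebra.EssFiniteType.comp k ↥D (AdjoinRoot f)
  exact Algebra.EssFiniteType.of_surjective (splitEquiv D f hf).toAlgHom (splitEquiv D f hf).surjective

/-- **`D[β]` is a normal domain** when `D` is a normal local domain and `f` has irreducible separable
reduction (BC-N♯ `isDomain_and_isIntegrallyClosed_adjoinRoot_of_residue`, transported along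
`splitEquiv`). [this work] -/
theorem isIntegrallyClosed_splitModel [IsIntegrallyClosed ↥D] [IsLocalRing ↥D] (hf : f.Monic)
    (hirr : Irreducible (f.map (residue ↥D))) (hsep : (f.map (residue ↥D)).Separable) :
    IsIntegrallyClosed ↥(splitModel D f) :=
  (isIntegrallyClosed_of_equiv_adjoinRoot hf (hf.irreducible_of_irreducible_map (residue ↥D) f hirr)
    (isUnit_mk_derivative_of_separable_map hf hsep) (splitEquiv D f hf).toRingEquiv).2

/-! ### Local structure: `D[β]` is local with maximal ideal `𝔪_D·D[β]` -/

variable [IsLocalRing ↥D]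

/-- **`D[β]` is local** when `f` has irreducible reduction. [this work] -/
theorem isLocalRing_splitModel (hf : f.Monic) (hirr : Irreducible (f.map (residue ↥D))) :
    IsLocalRing ↥(splitModel D f) := by
  obtain ⟨hloc, -, -⟩ := adjoinRoot_isLocalRing_of_irreducible hf hirr
  exact (splitEquiv D f hf).toRingEquiv.isLocalRing

/-- **The upstairs prime** `P_f := 𝔪_D · D[β]`. [this work] -/
def splitPrime : Ideal ↥(splitModel D f) := (maximalIdeal ↥D).map (toSplitModel D f)

/-- `P_f` is the maximal ideal of the local ring `D[β]`. [this work] -/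
theorem splitPrime_eq_maximalIdeal (hf : f.Monic) (hirr : Irreducible (f.map (residue ↥D))) :
    haveI := isLocalRing_splitModel D f hf hirr
    splitPrime D f = maximalIdeal ↥(splitModel D f) := by
  haveI := isLocalRing_splitModel D f hf hirr
  obtain ⟨hloc, -, hmB⟩ := adjoinRoot_isLocalRing_of_irreducible hf hirr
  have h1 : toSplitModel D f =
      (splitEquiv D f hf).toRingEquiv.toRingHom.comp (algebraMap ↥D (AdjoinRoot f)) :=
    RingHom.ext fun d => toSplitModel_eq D f hf d
  rw [splitPrime, h1, ← Ideal.map_map, hmB]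
  exact map_maximalIdeal_of_surjective _ (splitEquiv D f hf).surjective

/-- `P_f` is maximal. [this work] -/
theorem isMaximal_splitPrime (hf : f.Monic) (hirr : Irreducible (f.map (residue ↥D))) :
    (splitPrime D f).IsMaximal := by
  haveI := isLocalRing_splitModel D f hf hirr
  rw [splitPrime_eq_maximalIdeal D f hf hirr]
  exact maximalIdeal.isMaximal _

/-- `P_f` is prime. [this work] -/
theorem isPrime_splitPrime (hf : f.Monic) (hirr : Irreducible (f.map (residue ↥D))) :
    (splitPrime D f).IsPrime :=
  (isMaximal_splitPrime D f hf hirr).isPrime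

/-- **`P_f` lies over `𝔪_D`**: `d ∈ D` goes to `P_f` iff `d ∈ 𝔪_D`. [this work] -/
theorem toSplitModel_mem_splitPrime_iff (hf : f.Monic) (hirr : Irreducible (f.map (residue ↥D)))
    (d : ↥D) : toSplitModel D f d ∈ splitPrime D f ↔ d ∈ maximalIdeal ↥D := by
  haveI := isLocalRing_splitModel D f hf hirr
  obtain ⟨hloc, hlh, -⟩ := adjoinRoot_isLocalRing_of_irreducible hf hirr
  rw [splitPrime_eq_maximalIdeal D f hf hirr, mem_maximalIdeal, mem_maximalIdeal, mem_nonunits_iff,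
    mem_nonunits_iff, toSplitModel_eq D f hf, not_iff_not]
  exact (isUnit_map_iff (splitEquiv D f hf).toRingEquiv _).trans (isUnit_map_iff (algebraMap ↥D _) d)

end Model

/-! ## The upstairs germ `D_f := locPrime (D[β]) (𝔪_D·D[β]) = D[β]` and its local-étale bundle over `D` -/

section Germ

variable (D : Subalgebra k K) [IsLocalRing ↥D] (f : (↥D)[X]) [Fact (Irreducible (f.map (algebraMap ↥D K)))]

/-- **The upstairs germ is the model itself**: `D[β]` is local with maximal ideal `P_f`, so
localising at `P_f` changes nothing. [this work] -/
theorem locPrime_splitPrime_eq (hf : f.Monic) (hirr : Irreducible (f.map (residue ↥D)))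
    (hPf : (splitPrime D f).IsPrime) :
    locPrime (splitModel D f) (splitPrime D f) hPf = (splitModel D f).toSubring := by
  haveI := isLocalRing_splitModel D f hf hirr
  refine le_antisymm ?_ (toSubring_le_locPrime _ _ _)
  rintro y ⟨a, b, ha, hb, hbP, rfl⟩
  rw [splitPrime_eq_maximalIdeal D f hf hirr] at hbP
  obtain ⟨u, hu⟩ := IsLocalRing.notMem_maximalIdeal.mp hbP
  have hb0 : b ≠ 0 := fun h => by
    have : (⟨b, hb⟩ : ↥(splitModel D f)) = 0 := Subtype.ext h
    exact (IsLocalRing.notMem_maximalIdeal.mpr ⟨u, hu⟩) (this ▸ Ideal.zero_mem _)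
  have hinv : b⁻¹ = ((u⁻¹ : (↥(splitModel D f))ˣ) : ↥(splitModel D f)) := by
    refine inv_eq_of_mul_eq_one_right ?_
    have := congrArg (fun z : ↥(splitModel D f) => (z : AdjoinRoot (f.map (algebraMap ↥D K)))) u.mul_inv
    rwa [hu] at this
  exact Subalgebra.mem_toSubring.mpr ((splitModel D f).mul_mem ha (hinv ▸ (↑u⁻¹ : ↥(splitModel D f)).2))

/-- **The base-change map on germs `D → D_f`** (the inclusion along `K → K_f`). [this work] -/
def germMap (hPf : (splitPrime D f).IsPrime) : ↥D →+* ↥(locPrime (splitModel D f) (splitPrime D f) hPf) :=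
  ((algebraMap K (AdjoinRoot (f.map (algebraMap ↥D K)))).comp D.val.toRingHom).codRestrict _
    fun d => toSubring_le_locPrime _ _ _ (Subalgebra.mem_toSubring.mpr (algebraMap_mem_splitModel D f d.2))

/-- `D_f` as a `D`-algebra (registered instance; `algebraMap D D_f = germMap`). [this work] -/
instance germAlgebra (hPf : (splitPrime D f).IsPrime) :
    Algebra ↥D ↥(locPrime (splitModel D f) (splitPrime D f) hPf) := (germMap D f hPf).toAlgebra

/-- `algebraMap D D_f` on elements is the inclusion along `K → K_f`. [this work] -/
theorem coe_algebraMap_germ (hPf : (splitPrime D f).IsPrime) (d : ↥D) :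
    ((algebraMap ↥D ↥(locPrime (splitModel D f) (splitPrime D f) hPf) d :
      ↥(locPrime (splitModel D f) (splitPrime D f) hPf)) : AdjoinRoot (f.map (algebraMap ↥D K))) =
      algebraMap K (AdjoinRoot (f.map (algebraMap ↥D K))) (d : K) := rfl

/-- **`D[X]/(f) ≃+* D_f`** (`Φ` with values in the upstairs germ). [this work] -/
def splitGermEquiv (hf : f.Monic) (hirr : Irreducible (f.map (residue ↥D))) (hPf : (splitPrime D f).IsPrime) :
    AdjoinRoot f ≃+* ↥(locPrime (splitModel D f) (splitPrime D f) hPf) :=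
  RingEquiv.ofBijective
    ((modelHom D f).toRingHom.codRestrict _ fun x => by
      rw [locPrime_splitPrime_eq D f hf hirr hPf]
      exact Subalgebra.mem_toSubring.mpr ⟨x, rfl⟩)
    ⟨fun a b h => modelHom_injective D f hf (congrArg Subtype.val h), fun y => by
      have hy : (y : AdjoinRoot (f.map (algebraMap ↥D K))) ∈ (splitModel D f).toSubring := by
        rw [← locPrime_splitPrime_eq D f hf hirr hPf]; exact y.2
      obtain ⟨x, hx⟩ := Subalgebra.mem_toSubring.mp hy
      exact ⟨x, Subtype.ext hx⟩⟩

/-- Underlying element of `splitGermEquiv`. [this work] -/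
theorem coe_splitGermEquiv (hf : f.Monic) (hirr : Irreducible (f.map (residue ↥D)))
    (hPf : (splitPrime D f).IsPrime) (x : AdjoinRoot f) :
    ((splitGermEquiv D f hf hirr hPf x : ↥(locPrime (splitModel D f) (splitPrime D f) hPf)) :
      AdjoinRoot (f.map (algebraMap ↥D K))) = modelHom D f x := rfl

/-- **`D[X]/(f) ≃ₐ[D] D_f`**: the upstairs germ IS the splitting base of `D`. [this work] -/
def splitGermAlgEquiv (hf : f.Monic) (hirr : Irreducible (f.map (residue ↥D)))
    (hPf : (splitPrime D f).IsPrime) :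
    AdjoinRoot f ≃ₐ[↥D] ↥(locPrime (splitModel D f) (splitPrime D f) hPf) :=
  AlgEquiv.ofRingEquiv (f := splitGermEquiv D f hf hirr hPf) fun d =>
    Subtype.ext (by rw [coe_splitGermEquiv, AdjoinRoot.algebraMap_eq, modelHom_of]; rfl)

/-- `splitGermAlgEquiv` and `splitGermEquiv` agree. [this work] -/
theorem splitGermAlgEquiv_apply (hf : f.Monic) (hirr : Irreducible (f.map (residue ↥D)))
    (hPf : (splitPrime D f).IsPrime) (x : AdjoinRoot f) :
    splitGermAlgEquiv D f hf hirr hPf x = splitGermEquiv D f hf hirr hPf x := rfl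

/-- `algebraMap D D_f = splitGermEquiv ∘ (D → D[X]/(f))`. [this work] -/
theorem algebraMap_germ_eq (hf : f.Monic) (hirr : Irreducible (f.map (residue ↥D)))
    (hPf : (splitPrime D f).IsPrime) :
    algebraMap ↥D ↥(locPrime (splitModel D f) (splitPrime D f) hPf) =
      (splitGermEquiv D f hf hirr hPf).toRingHom.comp (algebraMap ↥D (AdjoinRoot f)) :=
  RingHom.ext fun d => ((splitGermAlgEquiv D f hf hirr hPf).commutes d).symm

/-- **`𝔪_D·D_f = 𝔪_(D_f)`.** [this work] -/
theorem map_maximalIdeal_germ (hf : f.Monic) (hirr : Irreducible (f.map (residue ↥D)))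
    (hPf : (splitPrime D f).IsPrime) :
    (maximalIdeal ↥D).map (algebraMap ↥D ↥(locPrime (splitModel D f) (splitPrime D f) hPf)) =
      maximalIdeal ↥(locPrime (splitModel D f) (splitPrime D f) hPf) := by
  obtain ⟨hloc, -, hmB⟩ := adjoinRoot_isLocalRing_of_irreducible hf hirr
  rw [algebraMap_germ_eq D f hf hirr hPf, ← Ideal.map_map, hmB]
  exact map_maximalIdeal_of_surjective _ (splitGermEquiv D f hf hirr hPf).surjective

/-- **`D → D_f` is a local homomorphism.** [this work] -/
theorem isLocalHom_germ (hf : f.Monic) (hirr : Irreducible (f.map (residue ↥D)))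
    (hPf : (splitPrime D f).IsPrime) :
    IsLocalHom (algebraMap ↥D ↥(locPrime (splitModel D f) (splitPrime D f) hPf)) :=
  isLocalHom_of_map_le (map_maximalIdeal_germ D f hf hirr hPf).le

/-- **`D_f` is Noetherian** when `D` is. [this work] -/
theorem isNoetherianRing_germ [IsNoetherianRing ↥D] (hf : f.Monic)
    (hirr : Irreducible (f.map (residue ↥D))) (hPf : (splitPrime D f).IsPrime) :
    IsNoetherianRing ↥(locPrime (splitModel D f) (splitPrime D f) hPf) := by
  haveI := hf.finite_adjoinRoot
  haveI : IsNoetherianRing (AdjoinRoot f) := IsNoetherianRing.of_finite ↥D (AdjoinRoot f)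
  exact isNoetherianRing_of_ringEquiv (AdjoinRoot f) (splitGermEquiv D f hf hirr hPf)

/-- **`D_f` is flat over `D`** (indeed free of rank `deg f`). [this work] -/
theorem flat_germ (hf : f.Monic) (hirr : Irreducible (f.map (residue ↥D))) (hPf : (splitPrime D f).IsPrime) :
    Module.Flat ↥D ↥(locPrime (splitModel D f) (splitPrime D f) hPf) := by
  haveI := hf.free_adjoinRoot
  exact Module.Flat.of_linearEquiv (splitGermAlgEquiv D f hf hirr hPf).symm.toLinearEquiv

/-- **`D_f` is finite over `D`.** [this work] -/
theorem finite_germ (hf : f.Monic) (hirr : Irreducible (f.map (residue ↥D))) (hPf : (splitPrime D f).IsPrime) :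
    Module.Finite ↥D ↥(locPrime (splitModel D f) (splitPrime D f) hPf) := by
  haveI := hf.finite_adjoinRoot
  exact Module.Finite.equiv (splitGermAlgEquiv D f hf hirr hPf).toLinearEquiv

/-- **`D_f` is étale over `D`** (separable reduction). [this work] -/
theorem etale_germ (hf : f.Monic) (hirr : Irreducible (f.map (residue ↥D)))
    (hsep : (f.map (residue ↥D)).Separable) (hPf : (splitPrime D f).IsPrime) :
    Algebra.Etale ↥D ↥(locPrime (splitModel D f) (splitPrime D f) hPf) := by
  haveI := isStandardEtale_adjoinRoot_of_separable_map hf hsep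
  exact Algebra.Etale.of_equiv (splitGermAlgEquiv D f hf hirr hPf)

/-- **THE SPLITTING: `κ(D_f) ≃ₐ[κ(D)] κ(D)[X]/(f̄)`.** [this work] -/
theorem nonempty_residueField_algEquiv (hf : f.Monic) (hirr : Irreducible (f.map (residue ↥D)))
    (hPf : (splitPrime D f).IsPrime) :
    haveI := isLocalHom_germ D f hf hirr hPf
    Nonempty (ResidueField ↥(locPrime (splitModel D f) (splitPrime D f) hPf) ≃ₐ[ResidueField ↥D]
      AdjoinRoot (f.map (residue ↥D))) := by
  haveI := isLocalHom_germ D f hf hirr hPf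
  obtain ⟨hloc, hlh, hmB⟩ := adjoinRoot_isLocalRing_of_irreducible hf hirr
  haveI : Fact (Irreducible (f.map (residue ↥D))) := ⟨hirr⟩
  -- `κ(D_f) ≃ κ(D[X]/(f)) = (D[X]/(f)) ⧸ 𝔪_D·(D[X]/(f)) ≃ κ(D)[X]/(f̄)`, over `D`, then over `κ(D)`
  have hmB' : maximalIdeal (AdjoinRoot f) = Ideal.map (AdjoinRoot.of f) (maximalIdeal ↥D) := by
    rw [← AdjoinRoot.algebraMap_eq]; exact hmB.symm
  let E : ResidueField ↥(locPrime (splitModel D f) (splitPrime D f) hPf) ≃ₐ[↥D]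
      AdjoinRoot (f.map (residue ↥D)) :=
    ((ResidueField.mapAlgEquiv (splitGermAlgEquiv D f hf hirr hPf)).symm.trans
      (Ideal.quotientEquivAlgOfEq ↥D hmB')).trans (AdjoinRoot.quotEquivQuotMap f (maximalIdeal ↥D))
  exact ⟨AlgEquiv.extendScalarsOfSurjective residue_surjective E⟩

/-- **`κ(D_f)/κ(D)` is separable** (and finite, an instance from `finite_germ`). [this work] -/
theorem isSeparable_residueField_germ [IsNoetherianRing ↥D] (hf : f.Monic)
    (hirr : Irreducible (f.map (residue ↥D)))
    (hsep : (f.map (residue ↥D)).Separable) (hPf : (splitPrime D f).IsPrime) :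
    haveI := isLocalHom_germ D f hf hirr hPf
    Algebra.IsSeparable (ResidueField ↥D) (ResidueField ↥(locPrime (splitModel D f) (splitPrime D f) hPf)) := by
  haveI := isLocalHom_germ D f hf hirr hPf
  obtain ⟨hloc, hlh, -, -, -, -, -, hsepκ, -, -, -⟩ := adjoinRoot_localEtale_bundle_of_irreducible hf hirr hsep
  exact Algebra.IsSeparable.of_algHom (ResidueField ↥D) (ResidueField (AdjoinRoot f))
    (ResidueField.mapAlgEquiv' (splitGermAlgEquiv D f hf hirr hPf)).symm.toAlgHom

/-- **`dim D_f = dim D`** (`D` Noetherian). [this work] -/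
theorem ringKrullDim_germ [IsNoetherianRing ↥D] (hf : f.Monic) (hirr : Irreducible (f.map (residue ↥D)))
    (hsep : (f.map (residue ↥D)).Separable) (hPf : (splitPrime D f).IsPrime) :
    ringKrullDim ↥(locPrime (splitModel D f) (splitPrime D f) hPf) = ringKrullDim ↥D := by
  obtain ⟨hloc, hlh, -, -, -, -, -, -, -, hdim, -⟩ := adjoinRoot_localEtale_bundle_of_irreducible hf hirr hsep
  rw [← hdim]
  exact (ringKrullDim_eq_of_ringEquiv (splitGermEquiv D f hf hirr hPf)).symm

/-- **`D_f` is regular iff `D` is** (`D` Noetherian). [this work] -/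
theorem isRegularLocalRing_germ_iff [IsNoetherianRing ↥D] (hf : f.Monic)
    (hirr : Irreducible (f.map (residue ↥D))) (hsep : (f.map (residue ↥D)).Separable)
    (hPf : (splitPrime D f).IsPrime) :
    IsRegularLocalRing ↥(locPrime (splitModel D f) (splitPrime D f) hPf) ↔ IsRegularLocalRing ↥D := by
  obtain ⟨hloc, hlh, -, -, -, -, -, -, -, -, hreg⟩ := adjoinRoot_localEtale_bundle_of_irreducible hf hirr hsep
  rw [← hreg]
  exact ⟨fun h => IsRegularLocalRing.of_ringEquiv (splitGermEquiv D f hf hirr hPf).symm,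
    fun h => IsRegularLocalRing.of_ringEquiv (splitGermEquiv D f hf hirr hPf)⟩

/-- **`D_f` is a normal domain** when `D` is (BC-N♯). [this work] -/
theorem isIntegrallyClosed_germ [IsIntegrallyClosed ↥D] (hf : f.Monic)
    (hirr : Irreducible (f.map (residue ↥D))) (hsep : (f.map (residue ↥D)).Separable)
    (hPf : (splitPrime D f).IsPrime) :
    IsIntegrallyClosed ↥(locPrime (splitModel D f) (splitPrime D f) hPf) := by
  obtain ⟨-, hic⟩ := isDomain_and_isIntegrallyClosed_adjoinRoot_of_residue hf hirr hsep
  exact IsIntegrallyClosed.of_equiv (splitGermEquiv D f hf hirr hPf)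

end Germ

end Summit.ResolutionOfSingularities.ResolutionOfSingularities.Theorems.NoZeno.SplittingBase

end
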